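import Literature.NumberTheory.LFunctions.SiegelWalfisz
import Literature.NumberTheory.LFunctions.LandauPageRealZeros
import HarnessLib

/-!
# Page's theorem with one exceptional prime removed, and the prime number theorem for
# arithmetic progressions uniformly for `log q ≤ (log x)^b`, `b < 1/4`

Topic `Literature/NumberTheory/LFunctions`. Everything in this file is PROVED (theorems only).

The Siegel–Walfisz theorem of the tree (`Literature.NumberTheory.LFunctions.siegel_walfisz_holds`,
Montgomery–Vaughan Cor. 11.19) is uniform only for `q ≤ (log x)^A`. Maier's matrix method
(`Literature/Barriers/Parity/EquidistributionLimits.lean`, `Maier1985_shortIntervals`) needs the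
prime number theorem for progressions to moduli `q` with `log q = (log x)^b` for some fixed
`b > 0`, which is beyond every power of `log x`. In that range Siegel's theorem is useless and one
argues with Page's theorem instead (Montgomery–Vaughan Cor. 11.10, Cor. 11.17; Davenport Ch. 20;
in the form "delete one prime factor of the exceptional conductor" of Ford–Maynard–Tao,
*Chains of large gaps between primes*, §2, Lemma 2.1 and Corollary 1). This file proves:

* `exists_exceptionalPrime` — **Page's theorem, `B_Q`-form** (MV Cor. 11.10 with FMT Cor. 1):
  there is an absolute `c_P > 0` such that for every `T ≥ 1` there is `B ∈ {1} ∪ {primes}` with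
  the property that for every modulus `q` with `log q ≤ T` and `(q, B) = 1`, every real zero `β`
  of every `L(s, χ)` with `χ` quadratic non-principal mod `q` satisfies `1 − β ≥ c_P/T`.
  Proof: if some quadratic `χ₀` mod `q₀`, `log q₀ ≤ T`, has a real zero `β₀ > 1 − c_P/T`, take
  `B` = the least prime factor of the conductor of `χ₀`; for `(q, B) = 1` and a second such pair
  `(χ mod q, β)`, either `χ₀χ` (mod `q₀q`) is non-principal and Landau's theorem
  (`Literature.NumberTheory.LFunctions.DirichletZFR.exists_landau_min_le`, MV Thm 11.7) bounds
  `min(β₀, β) ≤ 1 − c/log(4q₀q)`, or `χ₀χ = χ₀₀` and then `χ₀` factors through `gcd(q₀, q)`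
  (Mathlib `DirichletCharacter.factorsThrough_gcd`), so the conductor of `χ₀` divides `q` and
  `B ∣ q` — both absurd.
* `exists_classicalPsiData_of_realZeros` — the hypotheses of Landau's method for
  `Λ_{q,a} = φ(q)Λ𝟙_{≡ a}` (`Literature.NumberTheory.LFunctions.ClassicalPsiData`, MV Thm 6.9) with
  region constant `c_q = min(c₃/(1 + log q), η/8, c_ζ, 1/4)` when every real zero of every
  quadratic `L(s, χ)`, `χ` mod `q`, has `1 − β ≥ η` — the tree's
  `Literature.NumberTheory.LFunctions.SiegelWalfisz.exists_classicalPsiData` with Siegel's bound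
  `κ q^{-ε}` replaced by the hypothesis `η` (MV Thm 11.16, Cases 1 and 3).
* `chebyshevPsiMod_uniform` — **the PNT for progressions outside the exceptional prime**: for
  `0 < b < 1/4` and `ε > 0`, for all large `x` there is `B ∈ {1} ∪ {primes}` such that
  `|ψ(x; q, a) − x/φ(q)| ≤ ε x/φ(q)` for all `1 ≤ q`, `log q ≤ (log x)^b`, `(q, B) = 1`,
  `(a, q) = 1`. (From the two results above and the explicit Landau estimate
  `Literature.NumberTheory.LFunctions.ClassicalPsiData.abs_psi_sub_le_explicit`: the relative error
  is `≤ k q (log x)^{5b} exp(−m (log x)^{1/2−b})`, which tends to `0` because `b < 1/4`.)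
  Montgomery–Vaughan's Cor. 11.17 gives the range `log q ≤ c₁√log x`; the exponent `1/4` here is
  what the tree's form of Landau's method (region `σ > 1 − c_q/log(|t|+4)` with `c_q ≍ 1/log q`,
  and `|F_{q,a}| ≤ φ(q) max_χ |L'/L|`) yields, and it suffices for Maier's theorem.

## References

* H. L. Montgomery, R. C. Vaughan, *Multiplicative Number Theory I*, CUP 2007: Theorem 11.3
  (§11.1), Theorem 11.7 and Corollaries 11.8–11.10 (§11.2), Theorem 11.16 and Corollary 11.17
  (§11.3) (`MontgomeryVaughan2007`).
* K. Ford, J. Maynard, T. Tao, *Chains of large gaps between primes*, in: Irregularities in the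
  Distribution of Prime Numbers, Springer 2018, 1–21 (arXiv:1511.04468), §2: Lemma 2.1
  (Landau–Page), Corollary 1 ("`B_Q` … either equal to `1` or is a prime"), Lemma 2.2
  (`FordMaynardTao2018`) — the `B_Q` device.
* E. Landau 1918 (`Landau1918`), A. Page 1935 (MV §11.4 notes).
-/

noncomputable section

open Complex Filter Topology Metric Set Finset
open scoped LSeries.notation ArithmeticFunction.vonMangoldt

namespace Literature.NumberTheory.LFunctions.PageUniformPNT

/-! ## Page's theorem: one exceptional prime -/

/-- `log 4 ≤ 3`. [folklore] -/
theorem log_four_le_three : Real.log 4 ≤ 3 := by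
  have := Real.log_le_sub_one_of_pos (by norm_num : (0 : ℝ) < 4)
  linarith

/-- **Page's theorem in `B_Q`-form** (Montgomery–Vaughan Cor. 11.10; Ford–Maynard–Tao §2,
Lemma 2.1 and Corollary 1: "We can then eliminate the exceptional character by deleting at most
one prime factor of `Q`"): there is an absolute `c_P > 0` such that for every `T ≥ 1` there is a
natural number `B`, equal to `1` or prime, such that for all moduli `q ≥ 1` with `log q ≤ T` and
`(q, B) = 1`, all quadratic non-principal `χ` mod `q` and all real zeros `β` of `L(s, χ)`:
`c_P / T ≤ 1 − β`. (The prime `B`, when it is not `1`, is the least prime factor of the conductor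
of a quadratic character of some modulus `q₀`, `log q₀ ≤ T`, having a real zero `β₀ > 1 − c_P/T`.)
[cite: MontgomeryVaughan2007, Corollary 11.10] [cite: FordMaynardTao2018, §2 Corollary 1] -/
theorem exists_exceptionalPrime :
    ∃ cP : ℝ, 0 < cP ∧ ∀ T : ℝ, 1 ≤ T → ∃ B : ℕ, (B = 1 ∨ B.Prime) ∧
      ∀ (q : ℕ) [NeZero q], Real.log q ≤ T → q.Coprime B →
        ∀ χ : DirichletCharacter ℂ q, χ ^ 2 = 1 → χ ≠ 1 →
          ∀ β : ℝ, χ.LFunction β = 0 → cP / T ≤ 1 - β := by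
  classical
  obtain ⟨c, hc, H⟩ := DirichletZFR.exists_landau_min_le
  refine ⟨c / 5, by positivity, fun T hT ↦ ?_⟩
  by_cases hex : ∃ (q₀ : ℕ) (_ : NeZero q₀) (χ₀ : DirichletCharacter ℂ q₀) (β₀ : ℝ),
      Real.log q₀ ≤ T ∧ χ₀ ^ 2 = 1 ∧ χ₀ ≠ 1 ∧ χ₀.LFunction β₀ = 0 ∧ 1 - β₀ < c / 5 / T
  swap
  · -- no exceptional character at all: `B = 1`
    refine ⟨1, Or.inl rfl, fun q _ hqT _ χ hχ2 hχ1 β hβ ↦ ?_⟩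
    by_contra hlt
    exact hex ⟨q, inferInstance, χ, β, hqT, hχ2, hχ1, hβ, by linarith⟩
  obtain ⟨q₀, _, χ₀, β₀, hq₀T, hχ₀2, hχ₀1, hβ₀, hβ₀lt⟩ := hex
  have hcond : χ₀.conductor ≠ 1 := fun h ↦
    hχ₀1 (DirichletCharacter.eq_one_iff_conductor_eq_one.mpr h)
  have hprime : χ₀.conductor.minFac.Prime := Nat.minFac_prime hcond
  refine ⟨χ₀.conductor.minFac, Or.inr hprime, fun q _ hqT hcop χ hχ2 hχ1 β hβ ↦ ?_⟩
  by_contra hlt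
  push Not at hlt
  by_cases hψ : SiegelCoefficients.prodChar χ₀ χ = 1
  · -- `χ₀χ` principal: `χ₀` factors through `gcd(q₀, q)`, so `B ∣ conductor χ₀ ∣ q`
    have hinv : χ⁻¹ = χ := by rw [inv_eq_iff_mul_eq_one, ← sq, hχ2]
    have H' : χ₀.changeLevel (dvd_mul_right q₀ q) = χ.changeLevel (dvd_mul_left q q₀) := by
      have := eq_inv_of_mul_eq_one_left hψ
      rw [← map_inv, hinv] at this
      exact this
    have hft := DirichletCharacter.factorsThrough_gcd χ₀ χ H'
    have hdvd : χ₀.conductor ∣ q :=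
      (DirichletCharacter.conductor_dvd_of_mem_conductorSet χ₀ hft).trans (Nat.gcd_dvd_right q₀ q)
    have hB : χ₀.conductor.minFac ∣ q := (Nat.minFac_dvd _).trans hdvd
    have h1 : χ₀.conductor.minFac = 1 := Nat.Coprime.eq_one_of_dvd (Nat.coprime_comm.mp hcop) hB
    exact hprime.one_lt.ne' h1
  · -- Landau's repulsion for the non-principal `χ₀χ` (mod `q₀q`)
    haveI : NeZero (q₀ * q) := ⟨Nat.mul_ne_zero (NeZero.ne q₀) (NeZero.ne q)⟩
    have h := H q₀ q (q₀ * q) χ₀ χ (SiegelCoefficients.prodChar χ₀ χ) hχ₀1 hχ1 hψ hχ₀2 hχ2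
      (fun n ↦ SiegelCoefficients.prodChar_apply_natCast χ₀ χ n)
      (Nat.le_mul_of_pos_right q₀ (NeZero.pos q)) (Nat.le_mul_of_pos_left q (NeZero.pos q₀))
      β₀ β hβ₀ hβ
    have hq₀0 : (0 : ℝ) < q₀ := by exact_mod_cast NeZero.pos q₀
    have hq0 : (0 : ℝ) < q := by exact_mod_cast NeZero.pos q
    have hlogmul : Real.log ((q₀ * q : ℕ) : ℝ) = Real.log q₀ + Real.log q := by
      push_cast
      exact Real.log_mul hq₀0.ne' hq0.ne'
    have hsum : Real.log ((q₀ * q : ℕ) : ℝ) + Real.log 4 ≤ 5 * T := by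
      rw [hlogmul]
      linarith [log_four_le_three]
    have hpos : 0 < Real.log ((q₀ * q : ℕ) : ℝ) + Real.log 4 := by
      have h1 : 0 ≤ Real.log ((q₀ * q : ℕ) : ℝ) := Real.log_natCast_nonneg _
      have h2 : 0 < Real.log 4 := Real.log_pos (by norm_num)
      linarith
    have hle : c / 5 / T ≤ c / (Real.log ((q₀ * q : ℕ) : ℝ) + Real.log 4) := by
      rw [div_div]
      exact div_le_div_of_nonneg_left hc.le hpos hsum
    have hmin : 1 - c / 5 / T < min β₀ β := lt_min (by linarith) (by linarith)
    linarith

/-! ## Landau's hypotheses for `Λ_{q,a}` when the real zeros mod `q` are at distance `≥ η` from `1` -/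

/-- **The non-principal characters on the region, Page form** (MV Theorem 11.16, Cases 1 and 3,
with the hypothesis "every real zero `β` of every quadratic `L(s, χ)`, `χ` mod `q`, has
`1 − β ≥ η`" in place of Siegel's bound): with the constants `c₃, C₃` of
`Literature.NumberTheory.LFunctions.DirichletZFR.exists_norm_logDeriv_le_of_re_ge`, for `χ ≠ χ₀` mod `q` and `s` with
`σ > 1 − η/8`, `σ ≥ 1 − c₃/(log q + log(|t|+4))`: `L(s, χ) ≠ 0` and
`‖L'/L(s, χ)‖ ≤ C₃ ((log q + log 4)³/min(η/2,1)) log(|t|+4)` (every real zero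
`β > 1 − 2c₃/(log q + log 4)` belongs to a quadratic character by MV Theorem 11.3, hence is at
distance `≥ η − η/8 ≥ min(η/2, 1)` from `s`). The tree's
`Literature.NumberTheory.LFunctions.SiegelWalfisz.char_facts` is the case `η = κ q^{-ε}`.
[cite: MontgomeryVaughan2007, Theorem 11.16 (proof, Cases 1 and 3)] -/
theorem char_facts_of_realZeros {c₃ C₃ η : ℝ} (hη : 0 < η)
    (hzf : ∀ (q : ℕ) [NeZero q] (χ : DirichletCharacter ℂ q), χ ≠ 1 → ∀ ρ : ℂ, χ.LFunction ρ = 0 →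
        1 - 2 * c₃ / (Real.log q + Real.log (|ρ.im| + 4)) < ρ.re → χ ^ 2 = 1 ∧ ρ.im = 0)
    (hL : ∀ (q : ℕ) [NeZero q] (χ : DirichletCharacter ℂ q), χ ≠ 1 →
      ∀ (s : ℂ) (d : ℝ), 0 < d → d ≤ 1 →
        1 - c₃ / (Real.log q + Real.log (|s.im| + 4)) ≤ s.re →
        (∀ a : ℂ, χ.LFunction a = 0 → a.im = 0 →
          1 - 2 * c₃ / (Real.log q + Real.log 4) < a.re → d ≤ ‖s - a‖) →
        χ.LFunction s ≠ 0 ∧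
          ‖deriv χ.LFunction s / χ.LFunction s‖ ≤
            C₃ * ((Real.log q + Real.log 4) ^ 3 / d) * Real.log (|s.im| + 4))
    {q : ℕ} [NeZero q]
    (hηq : ∀ χ : DirichletCharacter ℂ q, χ ^ 2 = 1 → χ ≠ 1 → ∀ β : ℝ, χ.LFunction β = 0 → η ≤ 1 - β)
    (χ : DirichletCharacter ℂ q) (hχ : χ ≠ 1) {s : ℂ}
    (hsη : 1 - η / 8 < s.re)
    (hs₃ : 1 - c₃ / (Real.log q + Real.log (|s.im| + 4)) ≤ s.re) :
    χ.LFunction s ≠ 0 ∧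
      ‖deriv χ.LFunction s / χ.LFunction s‖ ≤
        C₃ * ((Real.log q + Real.log 4) ^ 3 / min (η / 2) 1) * Real.log (|s.im| + 4) := by
  have hd : 0 < min (η / 2) 1 := lt_min (by linarith) one_pos
  have hd1 : min (η / 2) 1 ≤ 1 := min_le_right _ _
  refine hL q χ hχ s _ hd hd1 hs₃ fun a hLa haim hare ↦ ?_
  obtain ⟨β, rfl⟩ : ∃ β : ℝ, a = β := ⟨a.re, Complex.ext (by simp) (by simp [haim])⟩
  simp only [Complex.ofReal_re] at hare
  have hχ2 : χ ^ 2 = 1 := by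
    refine (hzf q χ hχ β hLa ?_).1
    simpa only [Complex.ofReal_im, abs_zero, zero_add, Complex.ofReal_re] using hare
  have hβ := hηq χ hχ2 hχ β hLa
  have hre : (s - β).re = s.re - β := by simp
  have h1 : s.re - β ≤ ‖s - (β : ℂ)‖ := by rw [← hre]; exact Complex.re_le_norm _
  calc min (η / 2) 1 ≤ η / 2 := min_le_left _ _
    _ ≤ s.re - β := by linarith
    _ ≤ ‖s - (β : ℂ)‖ := h1

/-- **Hypotheses of Landau's method for `Λ_{q,a}`, Page form** (MV Theorem 11.16, Cases 1/3):
there are absolute constants `c₃, c_ζ > 0`, `C_ζ, C₃ ≥ 0` such that for every `q ≥ 1`, every unit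
`a` mod `q` and every `η > 0` such that all real zeros of all quadratic non-principal `L(s, χ)`,
`χ` mod `q`, satisfy `1 − β ≥ η`, the pair `Λ_{q,a}(n) = φ(q)Λ(n)𝟙_{n ≡ a (q)}`,
`F_{q,a} = φ(q)·`(Mathlib's `LFunctionResidueClassAux a`) satisfies
`Literature.NumberTheory.LFunctions.ClassicalPsiData Λ_{q,a} F_{q,a} c_q C_q` with
`c_q = min(c₃/(1 + log q), η/8, c_ζ, 1/4)` and `C_q = C_ζ + 3 log q + q C₃ (log q + log 4)³/min(η/2, 1)`.
Same proof as `Literature.NumberTheory.LFunctions.SiegelWalfisz.exists_classicalPsiData`, with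
`char_facts_of_realZeros` for `char_facts`. [cite: MontgomeryVaughan2007, Theorem 11.16 (proof, Cases 1 and 3)] -/
theorem exists_classicalPsiData_of_realZeros :
    ∃ c₃ cζ Cζ C₃ : ℝ, 0 < c₃ ∧ 0 < cζ ∧ 0 ≤ Cζ ∧ 0 ≤ C₃ ∧
      ∀ (q : ℕ) [NeZero q] (a : ZMod q), IsUnit a → ∀ η : ℝ, 0 < η →
        (∀ χ : DirichletCharacter ℂ q, χ ^ 2 = 1 → χ ≠ 1 → ∀ β : ℝ, χ.LFunction β = 0 → η ≤ 1 - β) →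
        ClassicalPsiData
          (fun n ↦ (q.totient : ℝ) * ArithmeticFunction.vonMangoldt.residueClass a n)
          (fun s ↦ (q.totient : ℂ) * ArithmeticFunction.vonMangoldt.LFunctionResidueClassAux a s)
          (min (min (c₃ / (1 + Real.log q)) (η / 8)) (min cζ (1 / 4)))
          (Cζ + 3 * Real.log q + q * (C₃ * ((Real.log q + Real.log 4) ^ 3 / min (η / 2) 1))) := by
  obtain ⟨c₃, hc₃, C₃, hC₃, hzf, hL⟩ := DirichletZFR.exists_norm_logDeriv_le_of_re_ge
  obtain ⟨cζ, hcζ, Cζ, hCζ, hζ⟩ := Literature.NumberTheory.LFunctions.classicalZFRData_riemannZeta.norm_logDeriv_le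
  refine ⟨c₃, cζ, Cζ, C₃, hc₃, hcζ, hCζ, hC₃, fun q _ a ha η hη hηq ↦ ?_⟩
  have hq1 : (1 : ℝ) ≤ q := by exact_mod_cast NeZero.one_le
  have hq0 : (0 : ℝ) < q := by linarith
  have hlogq : 0 ≤ Real.log q := Real.log_nonneg hq1
  have hd : 0 < min (η / 2) 1 := lt_min (by linarith) one_pos
  have hlog4 : 0 < Real.log 4 := Real.log_pos (by norm_num)
  -- the constants `c_q`, `B_q`
  set cq : ℝ := min (min (c₃ / (1 + Real.log q)) (η / 8)) (min cζ (1 / 4)) with hcq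
  have hcq0 : 0 < cq := lt_min (lt_min (div_pos hc₃ (by linarith)) (by linarith)) (lt_min hcζ (by norm_num))
  have hcq1 : cq ≤ c₃ / (1 + Real.log q) := (min_le_left _ _).trans (min_le_left _ _)
  have hcq2 : cq ≤ η / 8 := (min_le_left _ _).trans (min_le_right _ _)
  have hcq3 : cq ≤ cζ := (min_le_right _ _).trans (min_le_left _ _)
  have hcq4 : cq ≤ 1 / 4 := (min_le_right _ _).trans (min_le_right _ _)
  clear_value cq
  set B : ℝ := C₃ * ((Real.log q + Real.log 4) ^ 3 / min (η / 2) 1) with hBdef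
  have hB : 0 ≤ B := by rw [hBdef]; positivity
  clear_value B
  -- the analytic facts on the region
  have hregion : ∀ s : ℂ, 1 - cq / Real.log (|s.im| + 4) < s.re →
      DifferentiableAt ℂ
          (fun s ↦ (q.totient : ℂ) * ArithmeticFunction.vonMangoldt.LFunctionResidueClassAux a s) s ∧
        ‖(q.totient : ℂ) * ArithmeticFunction.vonMangoldt.LFunctionResidueClassAux a s‖ ≤
          (Cζ + 3 * Real.log q + q * B) * Real.log (|s.im| + 4) := by
    intro s hs
    obtain ⟨h34, hη8, hsζ, hs₃⟩ := SiegelWalfisz.region_facts hq1 hc₃ hcq0 hcq1 hcq2 hcq3 hcq4 hs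
    obtain ⟨hζne, hζb⟩ := hζ s (by linarith) hsζ
    have hχ : ∀ χ : DirichletCharacter ℂ q, χ ≠ 1 → χ.LFunction s ≠ 0 ∧
        ‖deriv χ.LFunction s / χ.LFunction s‖ ≤ B * Real.log (|s.im| + 4) := by
      intro χ hχ1
      have := char_facts_of_realZeros hη hzf hL hηq χ hχ1 hη8 hs₃
      rw [← hBdef] at this
      exact this
    exact SiegelWalfisz.residueClassAux_facts a hB h34.le hζne hζb hχ
  -- the structure
  refine ⟨hcq0, fun n ↦ ?_, fun s hs ↦ ?_, fun s hs ↦ ?_, fun s hs ↦ ?_, fun s hs ↦ (hregion s hs).2⟩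
  · exact mul_nonneg (Nat.cast_nonneg _) (ArithmeticFunction.vonMangoldt.residueClass_nonneg a n)
  · -- summability for `σ > 1`
    have h1 : LSeriesSummable (↗(ArithmeticFunction.vonMangoldt.residueClass a)) s :=
      LSeriesSummable_of_abscissaOfAbsConv_lt_re
        ((ArithmeticFunction.vonMangoldt.abscissaOfAbsConv_residueClass_le_one a).trans_lt
          (by exact_mod_cast hs))
    have h2 := h1.smul (q.totient : ℂ)
    refine (LSeriesSummable_congr s fun {n} _ ↦ ?_).1 h2
    simp only [Pi.smul_apply, smul_eq_mul]
    push_cast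
    ring
  · -- the identity `∑ Λ_{q,a}(n) n^{-s} = 1/(s−1) + F_{q,a}(s)` (MV (11.22))
    have hφ : (q.totient : ℂ) ≠ 0 := by exact_mod_cast (Nat.totient_pos.2 (NeZero.pos q)).ne'
    have hAux := ArithmeticFunction.vonMangoldt.eqOn_LFunctionResidueClassAux ha hs
    have hsm : LSeries (fun n ↦ (((q.totient : ℝ) * ArithmeticFunction.vonMangoldt.residueClass a n : ℝ) : ℂ)) s
        = (q.totient : ℂ) * LSeries (↗(ArithmeticFunction.vonMangoldt.residueClass a)) s := by
      rw [← LSeries_smul]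
      refine LSeries_congr (fun {n} _ ↦ ?_) s
      simp only [Pi.smul_apply, smul_eq_mul]
      push_cast
      ring
    rw [hsm]
    simp only at hAux
    rw [hAux]
    have hs1 : s - 1 ≠ 0 := by
      intro h; rw [sub_eq_zero] at h; rw [h] at hs; simp at hs
    field_simp
    ring
  · -- holomorphy on the region
    exact (hregion s hs).1.differentiableWithinAt

/-! ## The prime number theorem for progressions, uniformly for `log q ≤ (log x)^b`, `b < 1/4` -/

/-- The decay estimate behind `chebyshevPsiMod_uniform`: for `γ < 1`, `m > 0`, `k ≥ 0` and
`ε > 0` (with `γ < 1`), eventually `k u^{5γ} e^{u^γ} e^{−m u} ≤ ε`. [folklore] -/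
theorem eventually_decay_le {γ m k ε : ℝ} (hγ : γ < 1) (hm : 0 < m) (hk : 0 ≤ k)
    (hε : 0 < ε) :
    ∀ᶠ u : ℝ in atTop, k * u ^ (5 * γ) * Real.exp (u ^ γ) * Real.exp (-(m * u)) ≤ ε := by
  -- `u^γ ≤ (m/2) u` eventually
  have h1 : Tendsto (fun u : ℝ ↦ u ^ (-(1 - γ))) atTop (𝓝 0) := tendsto_rpow_neg_atTop (by linarith)
  have h2 : ∀ᶠ u : ℝ in atTop, u ^ γ ≤ m / 2 * u := by
    filter_upwards [h1.eventually (gt_mem_nhds (by positivity : (0 : ℝ) < m / 2)),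
      eventually_gt_atTop (0 : ℝ)] with u hu hu0
    have : u ^ γ = u ^ (-(1 - γ)) * u := by
      rw [← Real.rpow_add_one hu0.ne']
      ring_nf
    rw [this]
    exact mul_le_mul_of_nonneg_right hu.le hu0.le
  -- `k u^{5γ} e^{−(m/2)u} → 0`
  have h3 : Tendsto (fun u : ℝ ↦ k * (u ^ (5 * γ) * Real.exp (-(m / 2) * u))) atTop (𝓝 0) := by
    have := (tendsto_rpow_mul_exp_neg_mul_atTop_nhds_zero (5 * γ) (m / 2) (by positivity)).const_mul k
    simpa using this
  filter_upwards [h2, h3.eventually (gt_mem_nhds hε), eventually_gt_atTop (0 : ℝ)] with u hu hu' hu0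
  refine le_trans ?_ hu'.le
  have hexp : Real.exp (u ^ γ) * Real.exp (-(m * u)) ≤ Real.exp (-(m / 2) * u) := by
    rw [← Real.exp_add, Real.exp_le_exp]
    linarith
  have hpos : 0 ≤ k * u ^ (5 * γ) := mul_nonneg hk (Real.rpow_nonneg hu0.le _)
  calc k * u ^ (5 * γ) * Real.exp (u ^ γ) * Real.exp (-(m * u))
      = k * u ^ (5 * γ) * (Real.exp (u ^ γ) * Real.exp (-(m * u))) := by ring
    _ ≤ k * u ^ (5 * γ) * Real.exp (-(m / 2) * u) := mul_le_mul_of_nonneg_left hexp hpos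
    _ = k * (u ^ (5 * γ) * Real.exp (-(m / 2) * u)) := by ring

set_option maxHeartbeats 1600000 in
/-- **The prime number theorem for arithmetic progressions outside the exceptional prime**
(Page; Montgomery–Vaughan Cor. 11.17 with Cor. 11.10, in the `B_Q`-form of Ford–Maynard–Tao §2):
for `0 < b < 1/4` and `ε > 0` there is `X₀` such that for every `x ≥ X₀` there is a natural number
`B`, equal to `1` or prime, with
`|ψ(x; q, a) − x/φ(q)| ≤ ε · x/φ(q)` for all `q ≥ 1` with `log q ≤ (log x)^b`, `(q, B) = 1` and
all `(a, q) = 1`. Proof: with `T = (log x)^b` and `B` from `exists_exceptionalPrime`, every real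
zero mod `q` has `1 − β ≥ c_P/T`; `exists_classicalPsiData_of_realZeros` and the explicit Landau
estimate `Literature.NumberTheory.LFunctions.ClassicalPsiData.abs_psi_sub_le_explicit` give
`|φ(q)ψ(x;q,a) − x| ≤ k₃ q T⁵ x exp(−(m₁/24)√(log x)/T)`, and with `u = (log x)^{1/2−b}`,
`q ≤ e^T = e^{u^γ}`, `γ = b/(1/2 − b) < 1`, this is `≤ ε x` for large `x` (`eventually_decay_le`).
[cite: MontgomeryVaughan2007, Corollary 11.17 and Corollary 11.10] -/
theorem chebyshevPsiMod_uniform {b : ℝ} (hb0 : 0 < b) (hb : b < 1 / 4) {ε : ℝ} (hε : 0 < ε) :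
    ∃ X₀ : ℝ, ∀ x : ℝ, X₀ ≤ x → ∃ B : ℕ, (B = 1 ∨ B.Prime) ∧
      ∀ q : ℕ, 1 ≤ q → Real.log q ≤ Real.log x ^ b → q.Coprime B → ∀ a : (ZMod q)ˣ,
        |Literature.NumberTheory.Sieve.ParityWave0.chebyshevPsiMod q a x - x / q.totient| ≤
          ε * (x / q.totient) := by
  obtain ⟨c₃, cζ, Cζ, C₃, hc₃, hcζ, hCζ, hC₃, hData⟩ := exists_classicalPsiData_of_realZeros
  obtain ⟨cP, hcP, hPage⟩ := exists_exceptionalPrime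
  -- absolute constants
  set m₁ : ℝ := min (min (c₃ / 2) (cP / 8)) (min cζ (1 / 4)) with hm₁
  have hm₁0 : 0 < m₁ := lt_min (lt_min (by positivity) (by positivity)) (lt_min hcζ (by norm_num))
  have hm₁a : m₁ ≤ c₃ / 2 := (min_le_left _ _).trans (min_le_left _ _)
  have hm₁b : m₁ ≤ cP / 8 := (min_le_left _ _).trans (min_le_right _ _)
  have hm₁c : m₁ ≤ cζ := (min_le_right _ _).trans (min_le_left _ _)
  have hm₁d : m₁ ≤ 1 / 4 := (min_le_right _ _).trans (min_le_right _ _)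
  clear_value m₁
  set m₂ : ℝ := min (cP / 2) 1 with hm₂
  have hm₂0 : 0 < m₂ := lt_min (by positivity) one_pos
  have hm₂a : m₂ ≤ cP / 2 := min_le_left _ _
  have hm₂b : m₂ ≤ 1 := min_le_right _ _
  clear_value m₂
  set e : ℝ := Real.exp 1 with he
  have he0 : 0 < e := Real.exp_pos 1
  set k₁ : ℝ := Cζ + 3 + 64 * C₃ / m₂ with hk₁
  have hk₁0 : 0 ≤ k₁ := by rw [hk₁]; positivity
  set k₂ : ℝ := k₁ * (32 * e + 144 * Real.pi / m₁) + 1 with hk₂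
  have hk₂0 : 0 ≤ k₂ := by rw [hk₂]; positivity
  set k₃ : ℝ := 1 / 4 + 8 * k₂ + 9 * e ^ 2 with hk₃
  have hk₃0 : 0 ≤ k₃ := by rw [hk₃]; positivity
  -- the exponents
  set η : ℝ := 1 / 2 - b with hηdef
  have hη0 : 0 < η := by rw [hηdef]; linarith
  set γ : ℝ := b / η with hγdef
  have hγ1 : γ < 1 := by rw [hγdef, div_lt_one hη0, hηdef]; linarith
  have hγη : η * γ = b := by rw [hγdef]; field_simp
  -- the decay
  obtain ⟨u₀, hu₀⟩ := eventually_atTop.1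
    (eventually_decay_le (m := m₁ / 24) (k := k₃) hγ1 (by positivity) hk₃0 hε)
  refine ⟨max (Real.exp ((max u₀ 1) ^ (1 / η))) (Real.exp 1), fun x hx ↦ ?_⟩
  -- `x`, `Lx = log x`, `T = Lx^b`, `u = Lx^η`
  have hx1 : Real.exp 1 ≤ x := (le_max_right _ _).trans hx
  have hx0 : 0 < x := (Real.exp_pos 1).trans_le hx1
  have hx2 : 2 ≤ x := by
    have := Real.add_one_le_exp (1 : ℝ)
    linarith
  set Lx : ℝ := Real.log x with hLdef
  have hL1 : 1 ≤ Lx := by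
    rw [hLdef, ← Real.log_exp 1]
    exact Real.log_le_log (Real.exp_pos 1) hx1
  have hL0 : 0 < Lx := by linarith
  have hLu : (max u₀ 1) ^ (1 / η) ≤ Lx := by
    rw [hLdef, ← Real.log_exp ((max u₀ 1) ^ (1 / η))]
    exact Real.log_le_log (Real.exp_pos _) ((le_max_left _ _).trans hx)
  set T : ℝ := Lx ^ b with hTdef
  have hT1 : 1 ≤ T := Real.one_le_rpow hL1 hb0.le
  have hT0 : 0 < T := by linarith
  set u : ℝ := Lx ^ η with hudef
  have hu1 : max u₀ 1 ≤ u := by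
    have h0 : 0 ≤ max u₀ 1 := le_trans zero_le_one (le_max_right _ _)
    have : (max u₀ 1) = ((max u₀ 1) ^ (1 / η)) ^ η := by
      rw [← Real.rpow_mul h0, one_div_mul_cancel hη0.ne', Real.rpow_one]
    rw [this, hudef]
    exact Real.rpow_le_rpow (Real.rpow_nonneg h0 _) hLu hη0.le
  have hu₀u : u₀ ≤ u := (le_max_left _ _).trans hu1
  have hupos : 0 < u := lt_of_lt_of_le one_pos ((le_max_right _ _).trans hu1)
  have hTu : T = u ^ γ := by
    rw [hudef, hTdef, ← Real.rpow_mul hL0.le, hγη]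
  have hsqrt : Real.sqrt Lx = u * T := by
    rw [Real.sqrt_eq_rpow, hudef, hTdef, ← Real.rpow_add hL0, hηdef]
    norm_num
  have hdecay := hu₀ u hu₀u
  -- Page
  obtain ⟨B, hB, hP⟩ := hPage T hT1
  refine ⟨B, hB, fun q hq hqT hcop a ↦ ?_⟩
  haveI : NeZero q := ⟨by omega⟩
  have ha : IsUnit (a : ZMod q) := Units.isUnit a
  have hq1 : (1 : ℝ) ≤ q := by exact_mod_cast hq
  have hq0 : (0 : ℝ) < q := by linarith
  have hlogq0 : 0 ≤ Real.log q := Real.log_nonneg hq1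
  have hqexpT : (q : ℝ) ≤ Real.exp T := by
    rw [← Real.exp_log hq0]; exact Real.exp_le_exp.2 hqT
  -- the real zeros mod `q`
  have hηq : ∀ χ : DirichletCharacter ℂ q, χ ^ 2 = 1 → χ ≠ 1 → ∀ β : ℝ, χ.LFunction β = 0 →
      cP / T ≤ 1 - β := fun χ h2 h1 β hβ ↦ hP q hqT hcop χ h2 h1 β hβ
  have hδ0 : 0 < cP / T := div_pos hcP hT0
  -- lower bounds for `c_q` and `d_q`
  have hcq : m₁ / T ≤ min (min (c₃ / (1 + Real.log q)) (cP / T / 8)) (min cζ (1 / 4)) := by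
    have hmT : m₁ / T ≤ m₁ := div_le_self hm₁0.le hT1
    refine le_min (le_min ?_ ?_) (le_min (hmT.trans hm₁c) (hmT.trans hm₁d))
    · calc m₁ / T ≤ (c₃ / 2) / T := div_le_div_of_nonneg_right hm₁a hT0.le
        _ = c₃ / (2 * T) := by rw [div_div]
        _ ≤ c₃ / (1 + Real.log q) := div_le_div_of_nonneg_left hc₃.le (by linarith) (by linarith)
    · calc m₁ / T ≤ (cP / 8) / T := div_le_div_of_nonneg_right hm₁b hT0.le
        _ = cP / T / 8 := by ring
  have hdq : m₂ / T ≤ min (cP / T / 2) 1 := by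
    refine le_min ?_ ((div_le_self hm₂0.le hT1).trans hm₂b)
    calc m₂ / T ≤ (cP / 2) / T := div_le_div_of_nonneg_right hm₂a hT0.le
      _ = cP / T / 2 := by ring
  -- the data and Landau's explicit estimate
  have hD := hData q (a : ZMod q) ha (cP / T) hδ0 hηq
  have hPsi := hD.abs_psi_sub_le_explicit hx2
  set cq : ℝ := min (min (c₃ / (1 + Real.log q)) (cP / T / 8)) (min cζ (1 / 4)) with hcqdef
  set dq : ℝ := min (cP / T / 2) 1 with hdqdef
  have hcq0 : 0 < cq := lt_of_lt_of_le (div_pos hm₁0 hT0) hcq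
  have hcq4 : cq ≤ 1 / 4 := (min_le_right _ _).trans (min_le_right _ _)
  have hdq0 : 0 < dq := lt_of_lt_of_le (div_pos hm₂0 hT0) hdq
  have hdq1 : dq ≤ 1 := min_le_right _ _
  clear_value cq dq
  have hcq2 : cq ≤ 1 / 2 := by linarith only [hcq4]
  have hmin : min cq (1 / 2) = cq := min_eq_left hcq2
  rw [hmin] at hPsi
  revert hPsi
  clear hD
  -- bounds for the pieces of the constant
  have hlog40 : 0 < Real.log 4 := Real.log_pos (by norm_num)
  have hℒ₀ : Real.log q + Real.log 4 ≤ 4 * T := by linarith only [hqT, log_four_le_three, hT1]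
  have hℒ₀0 : 0 ≤ Real.log q + Real.log 4 := by linarith only [hlogq0, hlog40]
  have hinvd : 1 / dq ≤ T / m₂ := by
    rw [div_le_div_iff₀ hdq0 hm₂0]
    have := (div_le_iff₀ hT0).1 hdq
    linarith only [this]
  have hinvc : 1 / cq ≤ T / m₁ := by
    rw [div_le_div_iff₀ hcq0 hm₁0]
    have := (div_le_iff₀ hT0).1 hcq
    linarith only [this]
  have hT4 : 1 ≤ T ^ 4 := one_le_pow₀ hT1
  have hT5 : 1 ≤ T ^ 5 := one_le_pow₀ hT1
  have hTT4 : T ≤ T ^ 4 := le_self_pow₀ hT1 (by norm_num)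
  have hqT4 : 1 ≤ (q : ℝ) * T ^ 4 := one_le_mul_of_one_le_of_one_le hq1 hT4
  have hqT5 : 1 ≤ (q : ℝ) * T ^ 5 := one_le_mul_of_one_le_of_one_le hq1 hT5
  -- `C_q ≤ k₁ q T⁴`
  have hCq : Cζ + 3 * Real.log q + q * (C₃ * ((Real.log q + Real.log 4) ^ 3 / dq)) ≤
      k₁ * (q * T ^ 4) := by
    have h1 : (Real.log q + Real.log 4) ^ 3 ≤ 64 * T ^ 3 := by
      calc (Real.log q + Real.log 4) ^ 3 ≤ (4 * T) ^ 3 := pow_le_pow_left₀ hℒ₀0 hℒ₀ 3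
        _ = 64 * T ^ 3 := by ring
    have h2 : (Real.log q + Real.log 4) ^ 3 / dq ≤ 64 * T ^ 3 * (T / m₂) := by
      rw [div_eq_mul_one_div]
      exact mul_le_mul h1 hinvd (by positivity) (by positivity)
    have h3 : q * (C₃ * ((Real.log q + Real.log 4) ^ 3 / dq)) ≤ q * (C₃ * (64 * T ^ 3 * (T / m₂))) :=
      mul_le_mul_of_nonneg_left (mul_le_mul_of_nonneg_left h2 hC₃) hq0.le
    have h4 : q * (C₃ * (64 * T ^ 3 * (T / m₂))) = 64 * C₃ / m₂ * (q * T ^ 4) := by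
      field_simp
    have h5 : Cζ ≤ Cζ * (q * T ^ 4) := le_mul_of_one_le_right hCζ hqT4
    have h6 : 3 * Real.log q ≤ 3 * (q * T ^ 4) := by
      have : Real.log q ≤ q * T ^ 4 := by
        calc Real.log q ≤ T := hqT
          _ ≤ T ^ 4 := hTT4
          _ = 1 * T ^ 4 := (one_mul _).symm
          _ ≤ q * T ^ 4 := mul_le_mul_of_nonneg_right hq1 (by positivity)
      linarith only [this]
    have eq : k₁ * (q * T ^ 4) = Cζ * (q * T ^ 4) + 3 * (q * T ^ 4) + 64 * C₃ / m₂ * (q * T ^ 4) := by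
      rw [hk₁]; ring
    linarith only [h3, h4, h5, h6, eq]
  -- `C_q (32e + 12π/(c_q/12)) + 1 ≤ k₂ q T⁵`
  have hTk : (Cζ + 3 * Real.log q + q * (C₃ * ((Real.log q + Real.log 4) ^ 3 / dq))) *
      (32 * Real.exp 1 + 12 * Real.pi / (cq / 12)) + 1 ≤ k₂ * (q * T ^ 5) := by
    have hπ : 0 < Real.pi := Real.pi_pos
    have h1 : 12 * Real.pi / (cq / 12) = 144 * Real.pi * (1 / cq) := by field_simp; ring
    have h2 : 12 * Real.pi / (cq / 12) ≤ 144 * Real.pi / m₁ * T := by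
      rw [h1]
      calc 144 * Real.pi * (1 / cq) ≤ 144 * Real.pi * (T / m₁) :=
            mul_le_mul_of_nonneg_left hinvc (by positivity)
        _ = 144 * Real.pi / m₁ * T := by ring
    have h3 : 32 * Real.exp 1 + 12 * Real.pi / (cq / 12) ≤ (32 * e + 144 * Real.pi / m₁) * T := by
      rw [← he, add_mul]
      have : 32 * e ≤ 32 * e * T := le_mul_of_one_le_right (by positivity) hT1
      linarith only [h2, this]
    have hCq0 : 0 ≤ Cζ + 3 * Real.log q + q * (C₃ * ((Real.log q + Real.log 4) ^ 3 / dq)) := by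
      positivity
    have h32 : 0 ≤ 32 * Real.exp 1 + 12 * Real.pi / (cq / 12) := by positivity
    have hk₁U : 0 ≤ k₁ * (q * T ^ 4) := by positivity
    have h4 := mul_le_mul hCq h3 h32 hk₁U
    have h5 : k₁ * (q * T ^ 4) * ((32 * e + 144 * Real.pi / m₁) * T) =
        k₁ * (32 * e + 144 * Real.pi / m₁) * (q * T ^ 5) := by ring
    have e2 : k₂ * (q * T ^ 5) = k₁ * (32 * e + 144 * Real.pi / m₁) * (q * T ^ 5) + q * T ^ 5 := by
      rw [hk₂]; ring
    linarith only [h4, h5, hqT5, e2]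
  -- `ψ_Λ(6) ≤ 12 q`
  have hψ6 := SiegelWalfisz.psi_residue_six_le q (a : ZMod q)
  have hφq : (q.totient : ℝ) ≤ q := by exact_mod_cast Nat.totient_le q
  have hφ1 : (1 : ℝ) ≤ q.totient := by exact_mod_cast Nat.totient_pos.2 (NeZero.pos q)
  -- the full constant `K_q ≤ k₃ q T⁵`
  have hK : (1 / 4 + 8 * ((Cζ + 3 * Real.log q + q * (C₃ * ((Real.log q + Real.log 4) ^ 3 / dq))) *
      (32 * Real.exp 1 + 12 * Real.pi / (cq / 12)) + 1)) +
      (ClassicalPsiData.psi (fun n ↦ (q.totient : ℝ) * ArithmeticFunction.vonMangoldt.residueClass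
        (a : ZMod q) n) 6 + 6) * (Real.exp 2 / 2) ≤ k₃ * (q * T ^ 5) := by
    have h1 : Real.exp 2 = e ^ 2 := by rw [he, ← Real.exp_nat_mul]; norm_num
    have hqq : (q : ℝ) ≤ q * T ^ 5 := le_mul_of_one_le_right hq0.le hT5
    have h2 : (ClassicalPsiData.psi (fun n ↦ (q.totient : ℝ) *
        ArithmeticFunction.vonMangoldt.residueClass (a : ZMod q) n) 6 + 6) * (Real.exp 2 / 2) ≤
        9 * e ^ 2 * (q * T ^ 5) := by
      rw [h1]
      have h18 : ClassicalPsiData.psi (fun n ↦ (q.totient : ℝ) *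
          ArithmeticFunction.vonMangoldt.residueClass (a : ZMod q) n) 6 + 6 ≤ 18 * (q * T ^ 5) := by
        linarith only [hψ6, hφq, hqq, hqT5]
      have he2 : 0 ≤ e ^ 2 / 2 := by positivity
      calc (ClassicalPsiData.psi (fun n ↦ (q.totient : ℝ) *
            ArithmeticFunction.vonMangoldt.residueClass (a : ZMod q) n) 6 + 6) * (e ^ 2 / 2)
          ≤ 18 * (q * T ^ 5) * (e ^ 2 / 2) := mul_le_mul_of_nonneg_right h18 he2
        _ = 9 * e ^ 2 * (q * T ^ 5) := by ring
    have e3 : k₃ * (q * T ^ 5) = 1 / 4 * (q * T ^ 5) + 8 * (k₂ * (q * T ^ 5)) + 9 * e ^ 2 * (q * T ^ 5) := by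
      rw [hk₃]; ring
    linarith only [hTk, h2, hqT5, e3]
  -- the exponential factor
  have hexp : Real.exp (-(cq / 12 / 2) * Real.sqrt (Real.log x)) ≤ Real.exp (-(m₁ / 24 * u)) := by
    rw [Real.exp_le_exp, ← hLdef, hsqrt]
    have h1 : m₁ * u ≤ cq * (u * T) := by
      have := (div_le_iff₀ hT0).1 hcq
      calc m₁ * u ≤ (cq * T) * u := mul_le_mul_of_nonneg_right this hupos.le
        _ = cq * (u * T) := by ring
    have e4 : -(cq / 12 / 2) * (u * T) = -(cq * (u * T)) / 24 := by ring
    have e5 : -(m₁ / 24 * u) = -(m₁ * u) / 24 := by ring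
    rw [e4, e5]
    linarith only [h1]
  -- assemble: `|φ(q)ψ(x;q,a) − x| ≤ k₃ q T⁵ x e^{−m₁u/24} ≤ ε x`
  intro hPsi
  have hmain : |(q.totient : ℝ) * Literature.NumberTheory.Sieve.ParityWave0.chebyshevPsiMod q a x - x| ≤
      k₃ * (q * T ^ 5) * x * Real.exp (-(m₁ / 24 * u)) := by
    rw [← SiegelWalfisz.psi_residue_eq]
    refine hPsi.trans ?_
    have hKnn : 0 ≤ k₃ * (q * T ^ 5) := by positivity
    exact mul_le_mul (mul_le_mul_of_nonneg_right hK hx0.le) hexp (Real.exp_pos _).le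
      (mul_nonneg hKnn hx0.le)
  have hsmall : k₃ * (q * T ^ 5) * Real.exp (-(m₁ / 24 * u)) ≤ ε := by
    refine le_trans ?_ hdecay
    have hT5' : T ^ 5 = u ^ (5 * γ) := by
      rw [hTu, ← Real.rpow_natCast, ← Real.rpow_mul hupos.le]
      ring_nf
    have hqexp : (q : ℝ) ≤ Real.exp (u ^ γ) := by rw [← hTu]; exact hqexpT
    have : k₃ * (q * T ^ 5) * Real.exp (-(m₁ / 24 * u)) =
        k₃ * u ^ (5 * γ) * q * Real.exp (-(m₁ / 24 * u)) := by rw [hT5']; ring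
    rw [this]
    have hnn : 0 ≤ k₃ * u ^ (5 * γ) := mul_nonneg hk₃0 (Real.rpow_nonneg hupos.le _)
    exact mul_le_mul_of_nonneg_right (mul_le_mul_of_nonneg_left hqexp hnn) (Real.exp_pos _).le
  -- conclude
  have hφ0 : (0 : ℝ) < q.totient := by linarith
  have hdiv : |Literature.NumberTheory.Sieve.ParityWave0.chebyshevPsiMod q a x - x / q.totient| =
      |(q.totient : ℝ) * Literature.NumberTheory.Sieve.ParityWave0.chebyshevPsiMod q a x - x| / q.totient := by
    rw [← abs_of_pos hφ0, ← abs_div, abs_of_pos hφ0]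
    congr 1
    field_simp
  rw [hdiv, div_le_iff₀ hφ0]
  calc |(q.totient : ℝ) * Literature.NumberTheory.Sieve.ParityWave0.chebyshevPsiMod q a x - x|
      ≤ k₃ * (q * T ^ 5) * x * Real.exp (-(m₁ / 24 * u)) := hmain
    _ = (k₃ * (q * T ^ 5) * Real.exp (-(m₁ / 24 * u))) * x := by ring
    _ ≤ ε * x := mul_le_mul_of_nonneg_right hsmall hx0.le
    _ = ε * (x / q.totient) * q.totient := by field_simp

end Literature.NumberTheory.LFunctions.PageUniformPNT
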